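import Summits.Ventures.PercRepro.FaceGrouping

/-!
# PercRepro — CYCLE-MS′: mine-1's coloured Marica–Schönheim inequality implies Lemma B, hence C-005 (typer-2, gen 4)

mine-1 08:05:16Z (CONJECTURES v41 row (Θ); ASSIGNMENTS v30 typer-2 (a)): for a monotone map
`c : 2^S → Part(4)` let `A, B, C` be the antipodal pairs of the three CYCLIC crossing orientations
`(x₀,x₁), (x₁,x₂), (x₂,x₀)` (`antiFam c i j`) and `A*, B*, C*` their complement families. Every
member of
  `D := (A∖A) ∪ (B∖B) ∪ (C∖C) ∪ (A∧B) ∪ (B∧C) ∪ (C∧A) ∪ (A∨B)ᶜ ∪ (B∨C)ᶜ ∪ (C∨A)ᶜ`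
is the `⊥`-side of a GOOD antipodal pair (the LATTICE LEMMA `famD_subset`: `xᵢ ⊓ xⱼ = ⊥`,
`xᵢ ⊔ xⱼ = ⊤` and monotonicity), so `g ≥ |D|`; the set-theoretic conjecture

* **`CycleMS`** — for families `A, B, C` of subsets of a finite set whose six families
  `A, B, C, A*, B*, C*` are pairwise disjoint, `|A| + |B| + |C| ≤ |D|` (Marica–Schönheim for
  `B = C = ∅`; the two-type theorem for `C = ∅`)

therefore gives `b = |A| + |B| + |C| ≤ |D| ≤ g`: **`lemmaBAbstract_of_cycleMS : CycleMS → LemmaBAbstract`**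
and **`C005_of_cycleMS : CycleMS → C005`** (through `C005_of_LemmaBAbstract`).

mine-1 08:13:24Z: the HYPOTHESIS-FREE form **`ThetaMS`** (Θ) — `|D| ≥ #{complementary pairs {x, xᶜ}
meeting A ∪ B ∪ C}` (`pairsOf`), SAT-exhaustive at `d ≤ 4`; under the six disjointness hypotheses
every member of `A ∪ B ∪ C` lies in its own pair (`pairsOf_card_of_disjoint`), so
**`cycleMS_of_thetaMS : ThetaMS → CycleMS`** and **`C005_of_thetaMS`**.
-/

namespace PercRepro

open Finset

section Families

variable {S : Type*} [Fintype S] [DecidableEq S]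

/-- Differences of two families: `{x ⊓ yᶜ}`. -/
def famDiff (X Y : Finset (Config S)) : Finset (Config S) := (X ×ˢ Y).image fun p => p.1 ⊓ p.2ᶜ

/-- Meets of two families: `{x ⊓ y}`. -/
def famMeet (X Y : Finset (Config S)) : Finset (Config S) := (X ×ˢ Y).image fun p => p.1 ⊓ p.2

/-- Complements of joins of two families: `{(x ⊔ y)ᶜ}`. -/
def famJoinCompl (X Y : Finset (Config S)) : Finset (Config S) :=
  (X ×ˢ Y).image fun p => (p.1 ⊔ p.2)ᶜ

/-- The complement family `X* = {xᶜ}`. -/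
def famCompl (X : Finset (Config S)) : Finset (Config S) := X.image compl

/-- mine-1's set `D`. -/
def famD (A B C : Finset (Config S)) : Finset (Config S) :=
  famDiff A A ∪ famDiff B B ∪ famDiff C C ∪ famMeet A B ∪ famMeet B C ∪ famMeet C A ∪
    famJoinCompl A B ∪ famJoinCompl B C ∪ famJoinCompl C A

omit [DecidableEq S] in
/-- Membership in a difference family. -/
theorem mem_famDiff {X Y : Finset (Config S)} {z : Config S} :
    z ∈ famDiff X Y ↔ ∃ x ∈ X, ∃ y ∈ Y, x ⊓ yᶜ = z := by
  simp only [famDiff, Finset.mem_image, Finset.mem_product, Prod.exists]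
  exact ⟨fun ⟨a, b, ⟨ha, hb⟩, h⟩ => ⟨a, ha, b, hb, h⟩, fun ⟨a, ha, b, hb, h⟩ => ⟨a, b, ⟨ha, hb⟩, h⟩⟩

omit [DecidableEq S] in
/-- Membership in a meet family. -/
theorem mem_famMeet {X Y : Finset (Config S)} {z : Config S} :
    z ∈ famMeet X Y ↔ ∃ x ∈ X, ∃ y ∈ Y, x ⊓ y = z := by
  simp only [famMeet, Finset.mem_image, Finset.mem_product, Prod.exists]
  exact ⟨fun ⟨a, b, ⟨ha, hb⟩, h⟩ => ⟨a, ha, b, hb, h⟩, fun ⟨a, ha, b, hb, h⟩ => ⟨a, b, ⟨ha, hb⟩, h⟩⟩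

omit [DecidableEq S] in
/-- Membership in a complemented-join family. -/
theorem mem_famJoinCompl {X Y : Finset (Config S)} {z : Config S} :
    z ∈ famJoinCompl X Y ↔ ∃ x ∈ X, ∃ y ∈ Y, (x ⊔ y)ᶜ = z := by
  simp only [famJoinCompl, Finset.mem_image, Finset.mem_product, Prod.exists]
  exact ⟨fun ⟨a, b, ⟨ha, hb⟩, h⟩ => ⟨a, ha, b, hb, h⟩, fun ⟨a, ha, b, hb, h⟩ => ⟨a, b, ⟨ha, hb⟩, h⟩⟩

omit [DecidableEq S] in
/-- Membership in the complement family. -/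
theorem mem_famCompl {X : Finset (Config S)} {z : Config S} : z ∈ famCompl X ↔ zᶜ ∈ X := by
  simp only [famCompl, Finset.mem_image]
  constructor
  · rintro ⟨x, hx, rfl⟩
    rwa [compl_compl]
  · intro h
    exact ⟨zᶜ, h, compl_compl z⟩

omit [DecidableEq S] in
/-- The complement family has the same cardinality. -/
theorem card_famCompl (X : Finset (Config S)) : (famCompl X).card = X.card :=
  Finset.card_image_of_injective X compl_injective

end Families

/-- **CYCLE-MS′** (mine-1 08:05:16Z, CONJECTURES v41): for families `A, B, C` of subsets of a
finite set whose six families `A, B, C, A*, B*, C*` are pairwise disjoint,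
`|A| + |B| + |C| ≤ |D|`. -/
def CycleMS : Prop :=
  ∀ (S : Type) [Fintype S] [DecidableEq S] (A B C : Finset (Config S)),
    [A, B, C, famCompl A, famCompl B, famCompl C].Pairwise Disjoint →
      A.card + B.card + C.card ≤ (famD A B C).card

/-! ### The crossing families of a monotone map and the lattice lemma -/

section Map

variable {S : Type*} [Fintype S] [DecidableEq S]

open Classical in
/-- The antipodal pairs `(c ρ, c ρᶜ) = (xᵢ, xⱼ)` of a cube map, by their `xᵢ` member (the
`LemmaBAbstract.lean` class `crossFam cross4 c i j` without the `i ≠ j` guard). -/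
noncomputable def antiFam (c : Config S → Setoid (Fin 4)) (i j : Fin 3) : Finset (Config S) :=
  Finset.univ.filter fun ρ => c ρ = cross4 i ∧ c ρᶜ = cross4 j

open Classical in
/-- Membership in a crossing family. -/
theorem mem_antiFam {c : Config S → Setoid (Fin 4)} {i j : Fin 3} {ρ : Config S} :
    ρ ∈ antiFam c i j ↔ c ρ = cross4 i ∧ c ρᶜ = cross4 j := by
  simp [antiFam]

/-- The complement family of a crossing family is the reversed one. -/
theorem famCompl_antiFam (c : Config S → Setoid (Fin 4)) (i j : Fin 3) :
    famCompl (antiFam c i j) = antiFam c j i := by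
  ext ρ
  rw [mem_famCompl, mem_antiFam, mem_antiFam, compl_compl]
  exact and_comm

/-- Crossing families of different orientations are disjoint. -/
theorem disjoint_antiFam (c : Config S → Setoid (Fin 4)) {i j i' j' : Fin 3}
    (h : (i, j) ≠ (i', j')) : Disjoint (antiFam c i j) (antiFam c i' j') := by
  rw [Finset.disjoint_left]
  intro ρ h1 h2
  rw [mem_antiFam] at h1 h2
  apply h
  rw [Prod.ext_iff]
  exact ⟨cross4_injective (h1.1.symm.trans h2.1), cross4_injective (h1.2.symm.trans h2.2)⟩

/-- `crossCount` is the sum of the three crossing families with `i < j`. -/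
theorem crossCount_eq_sum_antiFam (c : Config S → Setoid (Fin 4)) :
    crossCount cross4 c =
      (antiFam c 0 1).card + (antiFam c 0 2).card + (antiFam c 1 2).card := by
  classical
  have hU : (Finset.univ.filter fun ω : Config S =>
      ∃ i j : Fin 3, i < j ∧ c ω = cross4 i ∧ c ωᶜ = cross4 j) =
      antiFam c 0 1 ∪ antiFam c 0 2 ∪ antiFam c 1 2 := by
    ext ρ
    simp only [Finset.mem_filter, Finset.mem_univ, true_and, Finset.mem_union, mem_antiFam]
    constructor
    · rintro ⟨i, j, hij, h1, h2⟩
      fin_cases i <;> fin_cases j <;> simp_all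
    · rintro ((⟨h1, h2⟩ | ⟨h1, h2⟩) | ⟨h1, h2⟩)
      · exact ⟨0, 1, by decide, h1, h2⟩
      · exact ⟨0, 2, by decide, h1, h2⟩
      · exact ⟨1, 2, by decide, h1, h2⟩
  rw [crossCount, hU, Finset.card_union_of_disjoint, Finset.card_union_of_disjoint]
  · exact disjoint_antiFam c (by decide)
  · rw [Finset.disjoint_union_left]
    exact ⟨disjoint_antiFam c (by decide), disjoint_antiFam c (by decide)⟩

omit [Fintype S] [DecidableEq S] in
/-- A configuration below two distinct crossing cells, whose complement is above two distinct
crossing cells, is the `⊥`-side of a good pair. -/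
theorem good_of_le {c : Config S → Setoid (Fin 4)} (hc : Monotone c) {z u v u' v' : Config S}
    {i j i' j' : Fin 3} (hzu : z ≤ u) (hzv : z ≤ v) (hu : c u = cross4 i) (hv : c v = cross4 j)
    (hij : i ≠ j) (hu' : u' ≤ zᶜ) (hv' : v' ≤ zᶜ) (hu'c : c u' = cross4 i') (hv'c : c v' = cross4 j')
    (hi'j' : i' ≠ j') : c z = ⊥ ∧ c zᶜ = ⊤ := by
  constructor
  · refine le_bot_iff.mp ?_
    rw [← cross4_inf_eq_bot hij, ← hu, ← hv]
    exact le_inf (hc hzu) (hc hzv)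
  · refine top_le_iff.mp ?_
    rw [← cross4_sup_eq_top hi'j', ← hu'c, ← hv'c]
    exact sup_le (hc hu') (hc hv')

/-- **The lattice lemma**: every member of `D` (for the cyclic families `A = (x₀,x₁)`,
`B = (x₁,x₂)`, `C = (x₂,x₀)`) is the `⊥`-side of a good pair. -/
theorem famD_subset {c : Config S → Setoid (Fin 4)} (hc : Monotone c) :
    famD (antiFam c 0 1) (antiFam c 1 2) (antiFam c 2 0) ⊆ famCompl (goodSet c) := by
  intro z hz
  rw [mem_famCompl]
  have key : c z = ⊥ ∧ c zᶜ = ⊤ → zᶜ ∈ goodSet c := fun h => by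
    classical
    simp only [goodSet, Finset.mem_filter, Finset.mem_univ, true_and, compl_compl]
    exact ⟨h.2, h.1⟩
  apply key
  simp only [famD, Finset.mem_union] at hz
  rcases hz with ((((((((hz | hz) | hz) | hz) | hz) | hz) | hz) | hz) | hz)
  · -- A ∖ A
    obtain ⟨a, ha, a', ha', rfl⟩ := mem_famDiff.mp hz
    rw [mem_antiFam] at ha ha'
    exact good_of_le hc inf_le_left inf_le_right ha.1 ha'.2 (by decide)
      (by rw [compl_inf, compl_compl]; exact le_sup_left)
      (by rw [compl_inf, compl_compl]; exact le_sup_right) ha.2 ha'.1 (by decide)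
  · -- B ∖ B
    obtain ⟨a, ha, a', ha', rfl⟩ := mem_famDiff.mp hz
    rw [mem_antiFam] at ha ha'
    exact good_of_le hc inf_le_left inf_le_right ha.1 ha'.2 (by decide)
      (by rw [compl_inf, compl_compl]; exact le_sup_left)
      (by rw [compl_inf, compl_compl]; exact le_sup_right) ha.2 ha'.1 (by decide)
  · -- C ∖ C
    obtain ⟨a, ha, a', ha', rfl⟩ := mem_famDiff.mp hz
    rw [mem_antiFam] at ha ha'
    exact good_of_le hc inf_le_left inf_le_right ha.1 ha'.2 (by decide)
      (by rw [compl_inf, compl_compl]; exact le_sup_left)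
      (by rw [compl_inf, compl_compl]; exact le_sup_right) ha.2 ha'.1 (by decide)
  · -- A ∧ B
    obtain ⟨a, ha, b, hb, rfl⟩ := mem_famMeet.mp hz
    rw [mem_antiFam] at ha hb
    exact good_of_le hc inf_le_left inf_le_right ha.1 hb.1 (by decide)
      (by rw [compl_inf]; exact le_sup_left) (by rw [compl_inf]; exact le_sup_right)
      ha.2 hb.2 (by decide)
  · -- B ∧ C
    obtain ⟨a, ha, b, hb, rfl⟩ := mem_famMeet.mp hz
    rw [mem_antiFam] at ha hb
    exact good_of_le hc inf_le_left inf_le_right ha.1 hb.1 (by decide)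
      (by rw [compl_inf]; exact le_sup_left) (by rw [compl_inf]; exact le_sup_right)
      ha.2 hb.2 (by decide)
  · -- C ∧ A
    obtain ⟨a, ha, b, hb, rfl⟩ := mem_famMeet.mp hz
    rw [mem_antiFam] at ha hb
    exact good_of_le hc inf_le_left inf_le_right ha.1 hb.1 (by decide)
      (by rw [compl_inf]; exact le_sup_left) (by rw [compl_inf]; exact le_sup_right)
      ha.2 hb.2 (by decide)
  · -- (A ∨ B)ᶜ
    obtain ⟨a, ha, b, hb, rfl⟩ := mem_famJoinCompl.mp hz
    rw [mem_antiFam] at ha hb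
    exact good_of_le hc (by rw [compl_sup]; exact inf_le_left) (by rw [compl_sup]; exact inf_le_right)
      ha.2 hb.2 (by decide) (by rw [compl_compl]; exact le_sup_left)
      (by rw [compl_compl]; exact le_sup_right) ha.1 hb.1 (by decide)
  · -- (B ∨ C)ᶜ
    obtain ⟨a, ha, b, hb, rfl⟩ := mem_famJoinCompl.mp hz
    rw [mem_antiFam] at ha hb
    exact good_of_le hc (by rw [compl_sup]; exact inf_le_left) (by rw [compl_sup]; exact inf_le_right)
      ha.2 hb.2 (by decide) (by rw [compl_compl]; exact le_sup_left)
      (by rw [compl_compl]; exact le_sup_right) ha.1 hb.1 (by decide)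
  · -- (C ∨ A)ᶜ
    obtain ⟨a, ha, b, hb, rfl⟩ := mem_famJoinCompl.mp hz
    rw [mem_antiFam] at ha hb
    exact good_of_le hc (by rw [compl_sup]; exact inf_le_left) (by rw [compl_sup]; exact inf_le_right)
      ha.2 hb.2 (by decide) (by rw [compl_compl]; exact le_sup_left)
      (by rw [compl_compl]; exact le_sup_right) ha.1 hb.1 (by decide)

/-- The six crossing families of a map are pairwise disjoint. -/
theorem pairwise_disjoint_antiFam (c : Config S → Setoid (Fin 4)) :
    [antiFam c 0 1, antiFam c 1 2, antiFam c 2 0, famCompl (antiFam c 0 1),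
      famCompl (antiFam c 1 2), famCompl (antiFam c 2 0)].Pairwise Disjoint := by
  simp only [famCompl_antiFam]
  have h : ([(0, 1), (1, 2), (2, 0), (1, 0), (2, 1), (0, 2)] : List (Fin 3 × Fin 3)).Pairwise
      (· ≠ ·) := by decide
  have hmap := h.map (fun p : Fin 3 × Fin 3 => antiFam c p.1 p.2)
    (fun p q hpq => disjoint_antiFam c (by simpa using hpq))
  simpa using hmap

end Map

/-- **CYCLE-MS′ gives the abstract Lemma B**: `b = |A| + |B| + |C| ≤ |D| ≤ g`. -/
theorem lemmaBAbstract_of_cycleMS (h : CycleMS) : LemmaBAbstract := by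
  intro S _ _ c hc
  have h1 := h S (antiFam c 0 1) (antiFam c 1 2) (antiFam c 2 0) (pairwise_disjoint_antiFam c)
  have h2 : (famD (antiFam c 0 1) (antiFam c 1 2) (antiFam c 2 0)).card ≤
      (famCompl (goodSet c)).card := Finset.card_le_card (famD_subset hc)
  have h3 : (famCompl (goodSet c)).card = topBotCount c := by
    rw [card_famCompl]
    rfl
  have h4 : (antiFam c 2 0).card = (antiFam c 0 2).card := by
    rw [← famCompl_antiFam, card_famCompl]
  rw [crossCount_eq_sum_antiFam]
  omega

/-- **CYCLE-MS′ gives C-005.** -/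
theorem C005_of_cycleMS (h : CycleMS) : C005 := C005_of_LemmaBAbstract (lemmaBAbstract_of_cycleMS h)

/-! ### (Θ): the hypothesis-free form -/

section Theta

variable {S : Type*} [Fintype S] [DecidableEq S]

/-- The complementary pairs `{x, xᶜ}` met by a family. -/
def pairsOf (X : Finset (Config S)) : Finset (Finset (Config S)) :=
  X.image fun x => ({x, xᶜ} : Finset (Config S))

omit [DecidableEq S] in
/-- The complement family of a union. -/
theorem famCompl_union (X Y : Finset (Config S)) :
    famCompl (X ∪ Y) = famCompl X ∪ famCompl Y :=
  Finset.image_union _ _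

omit [DecidableEq S] in
/-- A family disjoint from its complement family meets one pair per member. -/
theorem pairsOf_card_of_disjoint {X : Finset (Config S)} (h : Disjoint X (famCompl X)) :
    (pairsOf X).card = X.card := by
  unfold pairsOf
  refine Finset.card_image_of_injOn ?_
  intro x hx y hy hxy
  dsimp only at hxy
  have hx' : x ∈ ({y, yᶜ} : Finset (Config S)) := hxy ▸ Finset.mem_insert_self x {xᶜ}
  rw [Finset.mem_insert, Finset.mem_singleton] at hx'
  rcases hx' with rfl | rfl
  · rfl
  · exfalso
    have hmem : yᶜ ∈ famCompl X := mem_famCompl.mpr (by rw [compl_compl]; exact Finset.mem_coe.mp hy)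
    exact Finset.disjoint_left.mp h (Finset.mem_coe.mp hx) hmem

end Theta

/-- **(Θ)** (mine-1 08:13:24Z): hypothesis-free — `D` has at least as many members as there are
complementary pairs `{x, xᶜ}` meeting `A ∪ B ∪ C`. -/
def ThetaMS : Prop :=
  ∀ (S : Type) [Fintype S] [DecidableEq S] (A B C : Finset (Config S)),
    (pairsOf (A ∪ B ∪ C)).card ≤ (famD A B C).card

/-- **(Θ) gives CYCLE-MS′**: under the six disjointness hypotheses every member of `A ∪ B ∪ C`
lies in its own complementary pair. -/
theorem cycleMS_of_thetaMS (h : ThetaMS) : CycleMS := by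
  intro S _ _ A B C hd
  rw [List.pairwise_cons] at hd
  obtain ⟨hA, hd⟩ := hd
  rw [List.pairwise_cons] at hd
  obtain ⟨hB, hd⟩ := hd
  rw [List.pairwise_cons] at hd
  obtain ⟨hC, -⟩ := hd
  have hAB : Disjoint A B := hA _ (by simp)
  have hAC : Disjoint A C := hA _ (by simp)
  have hAA' : Disjoint A (famCompl A) := hA _ (by simp)
  have hAB' : Disjoint A (famCompl B) := hA _ (by simp)
  have hAC' : Disjoint A (famCompl C) := hA _ (by simp)
  have hBC : Disjoint B C := hB _ (by simp)
  have hBA' : Disjoint B (famCompl A) := hB _ (by simp)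
  have hBB' : Disjoint B (famCompl B) := hB _ (by simp)
  have hBC' : Disjoint B (famCompl C) := hB _ (by simp)
  have hCA' : Disjoint C (famCompl A) := hC _ (by simp)
  have hCB' : Disjoint C (famCompl B) := hC _ (by simp)
  have hCC' : Disjoint C (famCompl C) := hC _ (by simp)
  have hunion : Disjoint (A ∪ B ∪ C) (famCompl (A ∪ B ∪ C)) := by
    rw [famCompl_union, famCompl_union, Finset.disjoint_union_left, Finset.disjoint_union_left]
    refine ⟨⟨?_, ?_⟩, ?_⟩ <;> rw [Finset.disjoint_union_right, Finset.disjoint_union_right]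
    · exact ⟨⟨hAA', hAB'⟩, hAC'⟩
    · exact ⟨⟨hBA', hBB'⟩, hBC'⟩
    · exact ⟨⟨hCA', hCB'⟩, hCC'⟩
  have hcard : (A ∪ B ∪ C).card = A.card + B.card + C.card := by
    rw [Finset.card_union_of_disjoint (Finset.disjoint_union_left.mpr ⟨hAC, hBC⟩),
      Finset.card_union_of_disjoint hAB]
  rw [← hcard, ← pairsOf_card_of_disjoint hunion]
  exact h S A B C

/-- **(Θ) gives the abstract Lemma B.** -/
theorem lemmaBAbstract_of_thetaMS (h : ThetaMS) : LemmaBAbstract :=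
  lemmaBAbstract_of_cycleMS (cycleMS_of_thetaMS h)

/-- **(Θ) gives C-005.** -/
theorem C005_of_thetaMS (h : ThetaMS) : C005 := C005_of_LemmaBAbstract (lemmaBAbstract_of_thetaMS h)

end PercRepro
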